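/-
Copyright (c) 2026. All rights reserved.
Released under Apache 2.0 license as described in the file LICENSE.
-/
import Summits.Langlands.Langlands.Theorems.SoloInformedDcrisTrivialRank
import Summits.Langlands.Langlands.Theorems.SoloInformedWittInvariantsResidueField
import Summits.Langlands.Langlands.Theorems.SoloInformedRepairD2CrisTeichMinpoly
import Summits.Langlands.Langlands.Theorems.SoloInformedResidueFieldC
import Literature.NumberTheory.PAdicHodge.UnitRootPeriodWitt
import Mathlib.FieldTheory.Galois.Basic
import HarnessLib

/-!
# `dim_{ℚ_p} B_max(F)^{Γ_F} = f` and `dim D_cris(𝟙_m) = m·f` for unramified `F`, by Artin's lemma (solo programme, rung Λ9)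

Programme `solo-Langlands-informed`, repair of the crystalline clause D2-cris of `Summit.Langlands`
(`SpecC` = the comparison `B_max(F)^{Γ_F} = K₀`).  The clause `CrystallineCompatibleAt`
(`Theorems/SoloInformedRepairD2Cris`) predicts `dim_{ℚ̄_p} D_cris(𝟙_m) = m · f(F|ℚ_p)` for the trivial local
representation.  Rung Λ8b (`Theorems/SoloInformedDcrisTrivialRank`) proved `m·f ≤ dim D_cris(𝟙_m) ≤ m·[F:ℚ_p]`
for every `p`-adic field `F` and the equality `= m·f` under the single binder `[F : ℚ_p] = f`, i.e. the degree
formula `[F : ℚ_p] = e·f` at `e = 1`, which the tree does not have in this currency.  This file REMOVES that binder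
for absolutely unramified `F` (`p` a uniformiser), without any degree formula, completeness or compactness
argument, by a Frobenius/Artin count inside `W := B_max(F)^{Γ_F}`:

* §1 (pure field theory, Artin's lemma `[E : E^H] = |H|`, Mathlib `IntermediateField.finrank_fixedField_eq_card`)
  `finrank_le_of_algEquiv_pow_eq_one` : an intermediate field `E` of a finite extension `L/K` carrying a
  `K`-automorphism `σ` with `σ^f = 1` (`0 < f`) and `Fix(σ) = K` has `[E : K] ≤ f`;
  `finrank_le_of_iterate_eq_self` ★ : the same for any commutative `K`-algebra `A` embedding `K`-linearly into `L`
  and any `K`-algebra endomorphism `φ` of `A` with `φ^[f] = id` and `A^{φ=1} = K`;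
* §2 `phiInv` : the Frobenius `φ` of `B_max(F)` restricted to `W = B_max(F)^{Γ_F}` as a `ℚ_p`-algebra endomorphism;
* §3 for absolutely unramified `F` with `q_F = p^f` (the invariants are `p⁻ⁿ ι(z)`, `z ∈ W(k_F)`, rung Λ7
  `SpecC.forall_galBmax_iff_exists_witt_of_unramified`):
  `frobBmax_iterate_eq_self_of_unramified` ★ : **`φ^f = id` on `B_max(F)^{Γ_F}`** (`φ^f` raises Witt coordinates
  to the `q_F`-th power, the identity on `k_F`);
  `exists_eq_algebraMap_of_frobBmax_eq` ★ : **`(B_max(F)^{Γ_F})^{φ=1} = ℚ_p`** (`W(k̄)^{φ=1} = ℤ_p`, rung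
  `D2Cris.exists_eq_zpToWitt_of_frobenius_eq`);
* §4 `finrank_fixedSubalgebra_eq_of_unramified` ★★ : **`dim_{ℚ_p} B_max(F)^{Γ_F} = f`** for absolutely unramified
  `F` — `W ↪ F` `ℚ_p`-linearly (Λ8b `SpecC.invariantAlgHom`), so `W` is a finite field extension of `ℚ_p` inside
  `F` on which `φ` is an automorphism of order dividing `f` with fixed field `ℚ_p`: Artin gives `dim W ≤ f`, and
  `f ≤ dim W` is the Teichmüller lower bound of Λ8a; hence
  `finrank_Dcris_one_eq_of_unramified` ★★ : **`dim_{ℚ̄_p} D_cris(𝟙_m) = m · f` for every absolutely unramified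
  `p`-adic field `F`, with no further input** — the `𝟙_m` instance of the rank clause `n · f(v|p)` of
  `CrystallineCompatibleAt` at unramified places (`finrank_Dcris_one_eq_of_unramified'` discharges `θ` surjective
  by the tree's `surjective_fontaineTheta_integerC`).

References: Fontaine, Astérisque 223 (1994), Exp. II §2.3 (`φ` on `A_max`), Exp. III §1.5, §4.1; Colmez, Ann. of
Math. 148 (1998), §III.2 (`B_max^{G_K} = K₀`); Serre, *Local Fields* (1979), Ch. II §§5–6 (`W(k)`, Frobenius);
Artin, *Galois Theory* (1944), Thm. 14 (`[E : E^H] = |H|`); Buzzard–Gee, LMS LNS 414 (2014), Conj. 3.2.2.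
-/

noncomputable section

open scoped MatrixGroups TensorProduct ValuativeRel
open WittVector Field IsLocalRing ValuativeRel
open Literature.NumberTheory.GaloisRepresentations Literature.NumberTheory.PAdicHodge
open Literature.NumberTheory.GaloisRepresentations.IsNonarchimedeanLocalField

namespace Summit.Langlands.Langlands.Theorems

namespace SpecC

/-! ### §1 Artin's lemma: a `K`-algebra with an endomorphism of order `f` and fixed points `K` has dimension `≤ f` -/

section Artin

variable {K L : Type*} [Field K] [Field L] [Algebra K L] [FiniteDimensional K L]

/-- **Artin count.** An intermediate field `E` of a finite extension `L/K` with a `K`-automorphism `σ`, `σ^f = 1`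
(`0 < f`), whose fixed points lie in `K`, has `[E : K] ≤ f`: `[E : E^{⟨σ⟩}] = |⟨σ⟩| ≤ f` (Artin) and `E^{⟨σ⟩} = K`.
[cite: SerreLocalFields1979, Ch. II §5] -/
theorem finrank_le_of_algEquiv_pow_eq_one (E : IntermediateField K L) (σ : E ≃ₐ[K] E) {f : ℕ} (hf : 0 < f)
    (hσ : σ ^ f = 1) (hfix : ∀ x : E, σ x = x → ∃ c : K, x = algebraMap K E c) :
    Module.finrank K E ≤ f := by
  have h1 : Module.finrank (IntermediateField.fixedField (Subgroup.zpowers σ)) E = orderOf σ := by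
    rw [IntermediateField.finrank_fixedField_eq_card, Nat.card_zpowers]
  have h2 : IntermediateField.fixedField (Subgroup.zpowers σ) = ⊥ := by
    refine le_bot_iff.1 fun x hx => ?_
    rw [IntermediateField.mem_fixedField_iff] at hx
    obtain ⟨c, hc⟩ := hfix x (hx σ (Subgroup.mem_zpowers σ))
    exact IntermediateField.mem_bot.2 ⟨c, hc.symm⟩
  have h3 : Module.finrank K (IntermediateField.fixedField (Subgroup.zpowers σ)) = 1 :=
    IntermediateField.finrank_eq_one_iff.2 h2
  have h4 := Module.finrank_mul_finrank K (IntermediateField.fixedField (Subgroup.zpowers σ)) E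
  rw [h3, h1, one_mul] at h4
  rw [← h4]
  exact orderOf_le_of_pow_eq_one hf hσ

/-- ★ **Artin count for an embedded algebra.** A commutative `K`-algebra `A` that embeds `K`-linearly into a finite
extension `L` of `K` and carries a `K`-algebra endomorphism `φ` with `φ^[f] = id` (`0 < f`) and `A^{φ = 1} = K` has
`dim_K A ≤ f` (transport to the intermediate field `ι(A) ⊆ L`, on which `φ` becomes an automorphism, and
`finrank_le_of_algEquiv_pow_eq_one`). [cite: SerreLocalFields1979, Ch. II §5] -/
theorem finrank_le_of_iterate_eq_self {A : Type*} [CommRing A] [Algebra K A] (ι : A →ₐ[K] L)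
    (hι : Function.Injective ι) (φ : A →ₐ[K] A) {f : ℕ} (hf : 0 < f) (hφ : ∀ x, φ^[f] x = x)
    (hfix : ∀ x, φ x = x → ∃ c : K, x = algebraMap K A c) : Module.finrank K A ≤ f := by
  haveI : Algebra.IsAlgebraic K L := Algebra.IsAlgebraic.of_finite K L
  let E : IntermediateField K L := subalgebraEquivIntermediateField ι.range
  let e₁ : A ≃ₐ[K] ι.range := AlgEquiv.ofInjective ι hι
  let e₂ : ι.range ≃ₐ[K] E :=
    { toFun := fun x => ⟨x, x.2⟩
      invFun := fun x => ⟨x, x.2⟩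
      left_inv := fun _ => rfl
      right_inv := fun _ => rfl
      map_mul' := fun _ _ => rfl
      map_add' := fun _ _ => rfl
      commutes' := fun _ => rfl }
  let e : A ≃ₐ[K] E := e₁.trans e₂
  let ψ : E →ₐ[K] E := (e.toAlgHom.comp φ).comp e.symm.toAlgHom
  have hψe : ∀ a, ψ (e a) = e (φ a) := fun a => by
    show e (φ (e.symm (e a))) = e (φ a)
    rw [e.symm_apply_apply]
  have hψ_iter : ∀ n a, ψ^[n] (e a) = e (φ^[n] a) := by
    intro n
    induction n with
    | zero => intro a; rfl
    | succ n ih =>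
      intro a
      rw [Function.iterate_succ_apply', Function.iterate_succ_apply', ih, hψe]
  let σ : E ≃ₐ[K] E := AlgEquiv.ofBijective ψ (Algebra.IsAlgebraic.algHom_bijective ψ)
  have hσψ : (σ : E → E) = ψ := AlgEquiv.coe_ofBijective _ _
  have hσf : σ ^ f = 1 := by
    ext x
    rw [AlgEquiv.coe_pow, hσψ, AlgEquiv.one_apply]
    obtain ⟨a, rfl⟩ := e.surjective x
    rw [hψ_iter, hφ]
  have hfix' : ∀ x : E, σ x = x → ∃ c : K, x = algebraMap K E c := by
    intro x hx
    obtain ⟨a, rfl⟩ := e.surjective x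
    rw [show σ (e a) = ψ (e a) from congrFun hσψ (e a), hψe] at hx
    obtain ⟨c, hc⟩ := hfix a (e.injective hx)
    exact ⟨c, by rw [hc, AlgEquiv.commutes]⟩
  calc Module.finrank K A = Module.finrank K E := e.toLinearEquiv.finrank_eq
    _ ≤ f := finrank_le_of_algEquiv_pow_eq_one E σ hf hσf hfix'

end Artin

variable {F : Type} [Field F] [ValuativeRel F] [TopologicalSpace F] [IsNonarchimedeanLocalField F] [CharZero F]
  {p : ℕ} [Fact p.Prime] [Fact (¬ IsUnit (p : integerC F))] [IsAdicComplete (Ideal.span {(p : integerC F)}) (integerC F)]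

/-! ### §2 The Frobenius of `B_max(F)^{Γ_F}` -/

section Phi

/-- **`φ` on `B_max(F)^{Γ_F}`** as a `ℚ_p`-algebra endomorphism: the Frobenius `φ` of `B_max(F)` commutes with
`Γ_F` (`D2Cris.galBmaxAlgHom_comp_frobBmaxAlgHom`), so it preserves the invariants (`D2Cris.phiFix`).
[cite: FontaineAsterisque223III, Exp. II §2.3] -/
def phiInv : D2Cris.fixedSubalgebra (D2Cris.galBmaxAlgHom (F := F) (p := p)) →ₐ[ℚ_[p]]
    D2Cris.fixedSubalgebra (D2Cris.galBmaxAlgHom (F := F) (p := p)) :=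
  AlgHom.codRestrict ((D2Cris.frobBmaxAlgHom F p).comp (D2Cris.fixedSubalgebra _).val) _ fun w =>
    (D2Cris.phiFix (D2Cris.galBmaxAlgHom (F := F) (p := p)) (D2Cris.frobBmaxAlgHom F p)
      D2Cris.galBmaxAlgHom_comp_frobBmaxAlgHom w).2

/-- `(φ w : B_max) = φ (w : B_max)`. [folklore] -/
theorem coe_phiInv (w : D2Cris.fixedSubalgebra (D2Cris.galBmaxAlgHom (F := F) (p := p))) :
    ((phiInv w : D2Cris.fixedSubalgebra (D2Cris.galBmaxAlgHom (F := F) (p := p))) : D2Cris.Bmax F p) =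
      D2Cris.frobBmax F p w := rfl

/-- `(φ^[k] w : B_max) = φ^[k] (w : B_max)`. [folklore] -/
theorem coe_phiInv_iterate (k : ℕ) (w : D2Cris.fixedSubalgebra (D2Cris.galBmaxAlgHom (F := F) (p := p))) :
    ((phiInv^[k] w : D2Cris.fixedSubalgebra (D2Cris.galBmaxAlgHom (F := F) (p := p))) : D2Cris.Bmax F p) =
      (D2Cris.frobBmax F p)^[k] w := by
  induction k with
  | zero => rfl
  | succ k ih => rw [Function.iterate_succ_apply', Function.iterate_succ_apply', coe_phiInv, ih]

end Phi

/-! ### §3 `φ^f = id` on `B_max(F)^{Γ_F}` and `(B_max(F)^{Γ_F})^{φ=1} = ℚ_p`, for absolutely unramified `F` -/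

section Unramified

variable [Fact (¬ IsUnit (p : maxUnramifiedCompletion F))] [CharP (IsLocalRing.ResidueField (maxUnramifiedCompletion F)) p]
  (hp : valuation F p < 1) (hF : Function.Surjective (fontaineTheta (integerC F) p)) {m : ℕ}

omit [CharZero F] [Fact (¬ IsUnit (p : integerC F))] [IsAdicComplete (Ideal.span {(p : integerC F)}) (integerC F)]
  [Fact (¬ IsUnit (p : maxUnramifiedCompletion F))] in
/-- **`φ^f = id` on `W(k_F) ⊆ W(k̄)`** for `q_F = p^f`: `φ^f` raises every Witt coordinate to the `q_F`-th power
(`WittVector.iterate_frobenius_coeff`), the identity on `k_F` (`D2Cris.resBarField_pow_residueFieldCard`).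
[cite: SerreLocalFields1979, Ch. II §6] -/
theorem iterate_frobenius_map_resBarField {f : ℕ} (hq : residueFieldCard F = p ^ f) (w : WittVector p 𝓀[F]) :
    (WittVector.frobenius (p := p) (R := ResidueField (maxUnramifiedCompletion F)))^[f]
        (WittVector.map (D2Cris.resBarField F) w) = WittVector.map (D2Cris.resBarField F) w := by
  ext k
  rw [WittVector.iterate_frobenius_coeff, WittVector.map_coeff, ← hq]
  exact D2Cris.resBarField_pow_residueFieldCard _

omit [Fact (¬ IsUnit (p : maxUnramifiedCompletion F))] [CharP (IsLocalRing.ResidueField (maxUnramifiedCompletion F)) p] in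
/-- `φ^[k] (y · pⁿ) = φ^[k] y · pⁿ` in `B_max(F)`. [folklore] -/
theorem frobBmax_iterate_mul_natCast_pow (k n : ℕ) (y : D2Cris.Bmax F p) :
    (D2Cris.frobBmax F p)^[k] (y * (p : D2Cris.Bmax F p) ^ n) = (D2Cris.frobBmax F p)^[k] y * (p : D2Cris.Bmax F p) ^ n := by
  induction k with
  | zero => rfl
  | succ k ih => rw [Function.iterate_succ_apply', Function.iterate_succ_apply', ih, map_mul, map_pow, map_natCast]

/-- `φ^[k] ι(z) = ι(φ^[k] z)` for `z ∈ W(k̄)`, `ι : W(k̄) → 𝔸_inf → A_max → B_max(F)` (`φ` on `B_max(F)` extends the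
Witt-vector Frobenius: `D2Cris.frobBmax_algebraMap`, `frobBmaxPlus_ainfToBmaxPlus`, `wittToAinf_frobenius`).
[cite: FontaineAsterisque223III, Exp. II §2.3] -/
theorem frobBmax_iterate_algebraMap_wittToAinf (k : ℕ) (z : WittVector p (ResidueField (maxUnramifiedCompletion F))) :
    (D2Cris.frobBmax F p)^[k]
        (algebraMap (BmaxPlus F p) (D2Cris.Bmax F p) (ainfToBmaxPlus F p (wittToAinf F p z))) =
      algebraMap (BmaxPlus F p) (D2Cris.Bmax F p)
        (ainfToBmaxPlus F p (wittToAinf F p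
          ((WittVector.frobenius (p := p) (R := ResidueField (maxUnramifiedCompletion F)))^[k] z))) := by
  induction k with
  | zero => rfl
  | succ k ih =>
    rw [Function.iterate_succ_apply', Function.iterate_succ_apply', ih, D2Cris.frobBmax_algebraMap,
      frobBmaxPlus_ainfToBmaxPlus, wittToAinf_frobenius]

include hp hF in
/-- ★ **`φ^f = id` on `B_max(F)^{Γ_F}` for absolutely unramified `F`** (`p` a uniformiser, `q_F = p^f`): an invariant
period is `p⁻ⁿ ι(z)` with `z ∈ W(k_F)` (Λ7 `forall_galBmax_iff_exists_witt_of_unramified`), and `φ^f z = z`.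
[cite: Colmez1998Annals, §III.2] [cite: FontaineAsterisque223III, Exp. II §2.3] -/
theorem frobBmax_iterate_eq_self_of_unramified (hur : Irreducible (p : 𝒪[F])) {f : ℕ} (hq : residueFieldCard F = p ^ f)
    {y : D2Cris.Bmax F p} (hy : ∀ σ : absoluteGaloisGroup F, D2Cris.galBmax σ y = y) :
    (D2Cris.frobBmax F p)^[f] y = y := by
  haveI : CharP (ResidueField (integerC F)) p := charP_residueField_integerC
  obtain ⟨n, w, hw⟩ := (forall_galBmax_iff_exists_witt_of_unramified hp hF hur y).1 hy
  have h : (D2Cris.frobBmax F p)^[f] y * (p : D2Cris.Bmax F p) ^ n = y * (p : D2Cris.Bmax F p) ^ n := by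
    rw [← frobBmax_iterate_mul_natCast_pow, hw, frobBmax_iterate_algebraMap_wittToAinf,
      iterate_frobenius_map_resBarField hq]
  exact ((D2Cris.isUnit_natCast_bmax (F := F) (p := p)).pow n).mul_left_inj.1 h

omit [Fact (¬ IsUnit (p : maxUnramifiedCompletion F))] [CharP (IsLocalRing.ResidueField (maxUnramifiedCompletion F)) p] in
/-- `p · p⁻¹ = 1` in `B_max(F)` for the `ℚ_p`-structure (`p⁻¹ ∈ ℚ_p`). [folklore] -/
theorem natCast_mul_algebraMap_inv : (p : D2Cris.Bmax F p) * algebraMap ℚ_[p] (D2Cris.Bmax F p) (p : ℚ_[p])⁻¹ = 1 := by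
  rw [← map_natCast (algebraMap ℚ_[p] (D2Cris.Bmax F p)) p, ← map_mul,
    mul_inv_cancel₀ (Nat.cast_ne_zero.2 (Fact.out : p.Prime).ne_zero), map_one]

omit [Fact (¬ IsUnit (p : maxUnramifiedCompletion F))] [CharP (IsLocalRing.ResidueField (maxUnramifiedCompletion F)) p] in
/-- If `y · pⁿ ∈ ℚ_p` then `y ∈ ℚ_p` (in `B_max(F)`). [folklore] -/
theorem exists_eq_algebraMap_of_mul_pow_eq {y : D2Cris.Bmax F p} {n : ℕ} {c : ℚ_[p]}
    (h : y * (p : D2Cris.Bmax F p) ^ n = algebraMap ℚ_[p] (D2Cris.Bmax F p) c) :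
    ∃ c' : ℚ_[p], y = algebraMap ℚ_[p] (D2Cris.Bmax F p) c' := by
  refine ⟨c * ((p : ℚ_[p])⁻¹) ^ n, ?_⟩
  calc y = y * (p : D2Cris.Bmax F p) ^ n * (algebraMap ℚ_[p] (D2Cris.Bmax F p) (p : ℚ_[p])⁻¹) ^ n := by
        rw [mul_assoc, ← mul_pow, natCast_mul_algebraMap_inv, one_pow, mul_one]
    _ = algebraMap ℚ_[p] (D2Cris.Bmax F p) (c * ((p : ℚ_[p])⁻¹) ^ n) := by rw [h, ← map_pow, ← map_mul]

include hp hF in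
/-- ★ **`(B_max(F)^{Γ_F})^{φ = 1} = ℚ_p` for absolutely unramified `F`**: an invariant period `y = p⁻ⁿ ι(z)`,
`z ∈ W(k_F) ⊆ W(k̄)`, with `φ y = y` has `φ z = z` (`ι` is injective and `φ`-equivariant), so `z ∈ ℤ_p = W(𝔽_p)`
(`D2Cris.exists_eq_zpToWitt_of_frobenius_eq`) and `y = p⁻ⁿ z ∈ ℚ_p`.
[cite: Colmez1998Annals, §III.2] [cite: SerreLocalFields1979, Ch. II §6] -/
theorem exists_eq_algebraMap_of_frobBmax_eq (hur : Irreducible (p : 𝒪[F])) {y : D2Cris.Bmax F p}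
    (hy : ∀ σ : absoluteGaloisGroup F, D2Cris.galBmax σ y = y) (hφ : D2Cris.frobBmax F p y = y) :
    ∃ c : ℚ_[p], y = algebraMap ℚ_[p] (D2Cris.Bmax F p) c := by
  haveI : CharP (ResidueField (integerC F)) p := charP_residueField_integerC
  obtain ⟨n, w, hw⟩ := (forall_galBmax_iff_exists_witt_of_unramified hp hF hur y).1 hy
  generalize hz : WittVector.map (D2Cris.resBarField F) w = z at hw
  have h1 : algebraMap (BmaxPlus F p) (D2Cris.Bmax F p) (ainfToBmaxPlus F p (wittToAinf F p
        (WittVector.frobenius (p := p) (R := ResidueField (maxUnramifiedCompletion F)) z))) =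
      algebraMap (BmaxPlus F p) (D2Cris.Bmax F p) (ainfToBmaxPlus F p (wittToAinf F p z)) := by
    rw [wittToAinf_frobenius, ← frobBmaxPlus_ainfToBmaxPlus, ← D2Cris.frobBmax_algebraMap, ← hw, map_mul, map_pow,
      map_natCast, hφ]
  have h2 : WittVector.frobenius z = z := ainfToBmaxPlus_wittToAinf_injective (algebraMap_bmax_injective hp h1)
  obtain ⟨c, hc⟩ := D2Cris.exists_eq_zpToWitt_of_frobenius_eq h2
  have h3 := RingHom.congr_fun (D2Cris.wittToAinf_comp_zpToWitt (F := F) (p := p)) c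
  rw [RingHom.comp_apply] at h3
  refine exists_eq_algebraMap_of_mul_pow_eq (n := n) (c := (c : ℚ_[p])) ?_
  rw [hw, hc, h3, ← D2Cris.zpToBmax_eq_algebraMap]
  rfl

end Unramified

/-! ### §4 `dim_{ℚ_p} B_max(F)^{Γ_F} = f` and `dim_{ℚ̄_p} D_cris(𝟙_m) = m · f` for absolutely unramified `F` -/

section Main

variable [Fact (¬ IsUnit (p : maxUnramifiedCompletion F))] [CharP (IsLocalRing.ResidueField (maxUnramifiedCompletion F)) p]
  (hp : valuation F p < 1) (hF : Function.Surjective (fontaineTheta (integerC F) p)) {m : ℕ}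

include hp hF in
/-- **`φ^f = id` on `W = B_max(F)^{Γ_F}`** (absolutely unramified `F`, `q_F = p^f`), for the endomorphism `phiInv`.
[cite: Colmez1998Annals, §III.2] -/
theorem phiInv_iterate_eq_self (hur : Irreducible (p : 𝒪[F])) {f : ℕ} (hq : residueFieldCard F = p ^ f)
    (w : D2Cris.fixedSubalgebra (D2Cris.galBmaxAlgHom (F := F) (p := p))) : phiInv^[f] w = w :=
  Subtype.ext <| by
    rw [coe_phiInv_iterate]
    exact frobBmax_iterate_eq_self_of_unramified hp hF hur hq (forall_galBmax_coe w)

include hp hF in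
/-- **`W^{φ = 1} = ℚ_p` for `W = B_max(F)^{Γ_F}`** (absolutely unramified `F`), for the endomorphism `phiInv`.
[cite: Colmez1998Annals, §III.2] -/
theorem exists_eq_algebraMap_of_phiInv_eq (hur : Irreducible (p : 𝒪[F]))
    (w : D2Cris.fixedSubalgebra (D2Cris.galBmaxAlgHom (F := F) (p := p))) (hw : phiInv w = w) :
    ∃ c : ℚ_[p], w = algebraMap ℚ_[p] (D2Cris.fixedSubalgebra (D2Cris.galBmaxAlgHom (F := F) (p := p))) c := by
  have h : D2Cris.frobBmax F p (w : D2Cris.Bmax F p) = w := by rw [← coe_phiInv, hw]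
  obtain ⟨c, hc⟩ := exists_eq_algebraMap_of_frobBmax_eq hp hF hur (forall_galBmax_coe w) h
  exact ⟨c, Subtype.ext hc⟩

include hp hF in
/-- ★ **`dim_{ℚ_p} B_max(F)^{Γ_F} ≤ f` for absolutely unramified `F`** (`q_F = p^f`): `W = B_max(F)^{Γ_F}` embeds
`ℚ_p`-linearly into `F` (Λ8b `invariantAlgHom`, `[F : ℚ_p] < ∞`), `φ^f = id` on `W` and `W^{φ=1} = ℚ_p`, so Artin's
count `finrank_le_of_iterate_eq_self` applies. [cite: Colmez1998Annals, §III.2] [cite: SerreLocalFields1979, Ch. II §5] -/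
theorem finrank_fixedSubalgebra_le_of_unramified (hur : Irreducible (p : 𝒪[F])) {f : ℕ}
    (hq : residueFieldCard F = p ^ f) :
    Module.finrank ℚ_[p] (D2Cris.fixedSubalgebra (D2Cris.galBmaxAlgHom (F := F) (p := p))) ≤ f := by
  have hf : 0 < f := Nat.pos_of_ne_zero <| by
    rintro rfl
    rw [pow_zero] at hq
    exact absurd hq (one_lt_residueFieldCard F).ne'
  letI := LocalField.padicAlgebra F p hp
  haveI : FiniteDimensional ℚ_[p] F := PadicBase.instFiniteDimensional (F := F) (p := p) hp
  exact finrank_le_of_iterate_eq_self (invariantAlgHom hp hF) (invariantAlgHom_injective hp hF) phiInv hf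
    (phiInv_iterate_eq_self hp hF hur hq) (exists_eq_algebraMap_of_phiInv_eq hp hF hur)

include hp hF in
/-- ★★ **`dim_{ℚ_p} B_max(F)^{Γ_F} = f` for absolutely unramified `F`** (`p` a uniformiser of `F`, `q_F = p^f`),
unconditionally: `B_max(F)^{Γ_F} = K₀` has `ℚ_p`-dimension `f` (`≤`: Artin; `≥`: the Teichmüller periods, Λ8a/Λ8b
`le_finrank_fixedSubalgebra_le`).  Removes the binder `[F : ℚ_p] = f` of Λ8b `finrank_fixedSubalgebra_eq_of_finrank_eq`.
[cite: Colmez1998Annals, §III.2] [cite: FontaineAsterisque223III, Exp. III §1.5] -/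
theorem finrank_fixedSubalgebra_eq_of_unramified (hur : Irreducible (p : 𝒪[F])) {f : ℕ}
    (hq : residueFieldCard F = p ^ f) :
    Module.finrank ℚ_[p] (D2Cris.fixedSubalgebra (D2Cris.galBmaxAlgHom (F := F) (p := p))) = f :=
  le_antisymm (finrank_fixedSubalgebra_le_of_unramified hp hF hur hq) (le_finrank_fixedSubalgebra_le hp hF hq).1

include hp hF in
/-- ★★ **`dim_{ℚ̄_p} D_cris(𝟙_m) = m · f` for every absolutely unramified `p`-adic field `F`** (`p` a uniformiser,
`q_F = p^f`, `θ` surjective): the `𝟙_m` instance of the rank clause `n · f(v|p)` of `CrystallineCompatibleAt` at an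
unramified place, now free of the degree-formula binder of Λ8b `finrank_Dcris_one_eq_of_finrank_eq`.
[cite: BuzzardGeeLMS2014, Conj. 3.2.2] [cite: FontaineAsterisque223III, Exp. III §1.5] -/
theorem finrank_Dcris_one_eq_of_unramified (hur : Irreducible (p : 𝒪[F])) {f : ℕ} (hq : residueFieldCard F = p ^ f) :
    Module.finrank (PadicAlgCl p)
        (D2Cris.Dcris (F := F) (p := p) (1 : FramedRep (absoluteGaloisGroup F) (PadicAlgCl p) m)) = m * f := by
  rw [finrank_Dcris_one_eq hp hF, finrank_fixedSubalgebra_eq_of_unramified hp hF hur hq]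

include hp in
/-- ★★ **`dim_{ℚ̄_p} D_cris(𝟙_m) = m · f` for every absolutely unramified `p`-adic field `F`, input-free**: `θ` is
surjective for every `p`-adic field (tree `surjective_fontaineTheta_integerC`). [cite: BuzzardGeeLMS2014, Conj. 3.2.2] -/
theorem finrank_Dcris_one_eq_of_unramified' (hur : Irreducible (p : 𝒪[F])) {f : ℕ} (hq : residueFieldCard F = p ^ f) :
    Module.finrank (PadicAlgCl p)
        (D2Cris.Dcris (F := F) (p := p) (1 : FramedRep (absoluteGaloisGroup F) (PadicAlgCl p) m)) = m * f :=
  finrank_Dcris_one_eq_of_unramified hp (surjective_fontaineTheta_integerC hp) hur hq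

include hp in
/-- **`dim_{ℚ_p} B_max(F)^{Γ_F} = f` for absolutely unramified `F`, input-free** (`θ` surjective discharged).
[cite: Colmez1998Annals, §III.2] -/
theorem finrank_fixedSubalgebra_eq_of_unramified' (hur : Irreducible (p : 𝒪[F])) {f : ℕ}
    (hq : residueFieldCard F = p ^ f) :
    Module.finrank ℚ_[p] (D2Cris.fixedSubalgebra (D2Cris.galBmaxAlgHom (F := F) (p := p))) = f :=
  finrank_fixedSubalgebra_eq_of_unramified hp (surjective_fontaineTheta_integerC hp) hur hq

end Main

end SpecC

end Summit.Langlands.Langlands.Theorems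

end
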